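import Mathlib
import Summits.ValiantsHypothesis.ValiantsHypothesis.Theorems.BinomialElusiveBinomialCandidateCorankOneEliminantMembership
import Literature.RingTheory.PolynomialMaps.NumericToSymbolicHensel

/-!
# Crux `BinomialElusive.BinomialCandidate` (stmt-ValiantsHypothesis-7392), line `registered`,
# skeleton v6 — stub `stub_nondegenerateCorankTwo`, piece D': eliminant membership over
# `ℂ⟦W, X₁⟧`

This file proves the registered helper `eliminantMembership_option`: the Weierstrass eliminant
membership `corankOne_eliminantMembership`
(`…CorankOneEliminantMembership.lean`, coefficient ring `ℂ⟦W_0, …, W_{m-1}⟧ =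
MvPowerSeries (Fin m) ℂ`) ported to the coefficient ring
`A₁ := ℂ⟦W_0, …, W_{m-1}, X₁⟧ = MvPowerSeries (Option (Fin m)) ℂ` (`none = X₁`, `some i = W_i`),
over which the first of the two successive Weierstrass eliminations of the corank-two argument
runs.

We prove the statement once for an arbitrary finite index type `σ` and an arbitrary coefficient
field `K` (`eliminantMembership_sigma`) and specialise.  Let `A := K⟦(X_i)_{i ∈ σ}⟧`,
`𝔪 = (X_i)_i` its augmentation ideal (`A` is `𝔪`-adically complete: Mathlib's instance for
`MvPowerSeries σ R`, `σ` finite), and `F₀, F₁ ∈ A⟦X⟧` with `F₀ = Σ_j f_{0,j} X^j`,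
`f_{0,j}(0) = 0` for `j < d` and `f_{0,d}(0) ≠ 0` (`d ≥ 1`).  Membership in `𝔪` is vanishing of
the constant coefficient (`CorankTwoEliminant.mem_augIdeal_iff`, from the Literature lemma
`Literature.RingTheory.PolynomialMaps.mem_idealX_of_constantCoeff_eq_zero`), so the image of `F₀`
in `(A/𝔪)⟦X⟧` has order exactly `d` and `F₀` is a Weierstrass divisor of order `d` at `𝔪`.
Weierstrass division (`PowerSeries.IsWeierstrassDivisorAt.isWeierstrassDivisionAt_div_mod`) of
`X^j F₁`, `j < d`, by `F₀` gives `X^j F₁ = Q_j F₀ + Σ_{l<d} M_{lj} X^l` with `M_{lj} ∈ A`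
(`CorankOneEliminant.coe_eq_sum_of_degree_lt`), and the adjugate trick
`CorankOneEliminant.det_mem_span_pair` (valid over any commutative ring) yields
`det M ∈ (F₀, F₁)`, spelled `C (det M) = U F₀ + V F₁`.
-/

-- layout Summits/ValiantsHypothesis/ValiantsHypothesis forces the duplicated namespace component
set_option linter.dupNamespace false

noncomputable section

namespace Summit.ValiantsHypothesis.ValiantsHypothesis.Theorems.BinomialCandidateStubs

open scoped BigOperators

namespace CorankTwoEliminant

/-! ## The augmentation ideal of `R⟦(X_i)_{i ∈ σ}⟧`, `σ` finite -/

/-- Membership in the augmentation ideal `(X_i)_{i ∈ σ}` of `R⟦(X_i)_{i ∈ σ}⟧` (`σ` finite) is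
vanishing of the constant coefficient. -/
theorem mem_augIdeal_iff {R : Type*} [CommRing R] {σ : Type*} [Finite σ]
    {f : MvPowerSeries σ R} :
    f ∈ (Ideal.span (Set.range MvPowerSeries.X) : Ideal (MvPowerSeries σ R)) ↔
      MvPowerSeries.constantCoeff f = 0 := by
  constructor
  · intro hf
    have hle : (Ideal.span (Set.range MvPowerSeries.X) : Ideal (MvPowerSeries σ R)) ≤
        RingHom.ker (MvPowerSeries.constantCoeff (σ := σ) (R := R)) := by
      refine Ideal.span_le.mpr ?_
      rintro _ ⟨i, rfl⟩
      simp
    exact hle hf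
  · exact Literature.RingTheory.PolynomialMaps.mem_idealX_of_constantCoeff_eq_zero

/-! ## `F₀` is a Weierstrass divisor of order `d` -/

section Weierstrass

variable {K : Type*} [Field K] {σ : Type*} [Finite σ]
  (F₀ : PowerSeries (MvPowerSeries σ K)) (d : ℕ)
  (h0 : ∀ j < d, MvPowerSeries.constantCoeff (PowerSeries.coeff j F₀) = 0)
  (hd : MvPowerSeries.constantCoeff (PowerSeries.coeff d F₀) ≠ 0)
include h0 hd

/-- The image of `F₀` in `(A/𝔪)⟦X⟧ = K⟦X⟧` has order exactly `d`. -/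
theorem order_map_eq :
    (F₀.map (Ideal.Quotient.mk (Ideal.span (Set.range MvPowerSeries.X) :
      Ideal (MvPowerSeries σ K)))).order = d := by
  refine PowerSeries.order_eq_nat.mpr ⟨?_, ?_⟩
  · rw [PowerSeries.coeff_map, Ne, Ideal.Quotient.eq_zero_iff_mem, mem_augIdeal_iff]
    exact hd
  · intro i hi
    rw [PowerSeries.coeff_map, Ideal.Quotient.eq_zero_iff_mem, mem_augIdeal_iff]
    exact h0 i hi

/-- Numeric form of `order_map_eq` (so `F₀` is a Weierstrass divisor of order `d` at the
augmentation ideal: its `X^d`-coefficient is a unit of `A`). -/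
theorem order_toNat_eq :
    (F₀.map (Ideal.Quotient.mk (Ideal.span (Set.range MvPowerSeries.X) :
      Ideal (MvPowerSeries σ K)))).order.toNat = d := by
  rw [order_map_eq F₀ d h0 hd, ENat.toNat_coe]

/-- `F₀` is a Weierstrass divisor (of order `d`) at the augmentation ideal. -/
theorem isWeierstrassDivisorAt :
    F₀.IsWeierstrassDivisorAt (Ideal.span (Set.range MvPowerSeries.X) :
      Ideal (MvPowerSeries σ K)) := by
  unfold PowerSeries.IsWeierstrassDivisorAt
  rw [order_toNat_eq F₀ d h0 hd, MvPowerSeries.isUnit_iff_constantCoeff]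
  exact isUnit_iff_ne_zero.mpr hd

end Weierstrass

/-! ## Eliminant membership over `K⟦(X_i)_{i ∈ σ}⟧` -/

/-- **Eliminant membership over a finite-variable power series ring.**  For
`F₀, F₁ ∈ A⟦X⟧`, `A = K⟦(X_i)_{i ∈ σ}⟧` (`σ` finite, `K` a field), with `f_{0,j}(0) = 0` for
`j < d` and `f_{0,d}(0) ≠ 0` (`f_{0,j}` the `X^j`-coefficient of `F₀`, `d ≥ 1`), Weierstrass
division of `X^j F₁` (`j < d`) by `F₀` yields quotients `Q_j` and a `d × d` matrix `M` over `A`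
with `X^j F₁ = Q_j F₀ + Σ_{l<d} C (M_{lj}) X^l`, and `det M` lies in the ideal `(F₀, F₁)`:
`C (det M) = U F₀ + V F₁`. -/
theorem eliminantMembership_sigma {K : Type*} [Field K] {σ : Type*} [Finite σ] (d : ℕ)
    (F₀ F₁ : PowerSeries (MvPowerSeries σ K)) (hd : 1 ≤ d)
    (h0 : ∀ j < d, MvPowerSeries.constantCoeff (PowerSeries.coeff j F₀) = 0)
    (hdd : MvPowerSeries.constantCoeff (PowerSeries.coeff d F₀) ≠ 0) :
    ∃ (M : Matrix (Fin d) (Fin d) (MvPowerSeries σ K))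
      (Q : Fin d → PowerSeries (MvPowerSeries σ K)) (U V : PowerSeries (MvPowerSeries σ K)),
      (∀ j : Fin d, PowerSeries.X ^ (j : ℕ) * F₁ =
        Q j * F₀ + ∑ l : Fin d, PowerSeries.C (M l j) * PowerSeries.X ^ (l : ℕ)) ∧
      PowerSeries.C M.det = U * F₀ + V * F₁ := by
  have hn := order_toNat_eq F₀ d h0 hdd
  -- `F₀` is a Weierstrass divisor (of order `d`) at the augmentation ideal
  have H := isWeierstrassDivisorAt F₀ d h0 hdd
  -- the Weierstrass division data: remainders `M` and quotients `Q`
  set M : Matrix (Fin d) (Fin d) (MvPowerSeries σ K) :=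
    Matrix.of fun l j => (H.mod (PowerSeries.X ^ (j : ℕ) * F₁)).coeff l
  set Q : Fin d → PowerSeries (MvPowerSeries σ K) :=
    fun j => H.div (PowerSeries.X ^ (j : ℕ) * F₁)
  have hdiv : ∀ j : Fin d, PowerSeries.X ^ (j : ℕ) * F₁ =
      Q j * F₀ + ∑ l : Fin d, PowerSeries.C (M l j) * PowerSeries.X ^ (l : ℕ) := by
    intro j
    obtain ⟨hdeg, hE⟩ := H.isWeierstrassDivisionAt_div_mod (PowerSeries.X ^ (j : ℕ) * F₁)
    rw [hn] at hdeg
    rw [hE, CorankOneEliminant.coe_eq_sum_of_degree_lt _ hdeg, mul_comm F₀]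
    rfl
  -- membership of the determinant
  have hmem := CorankOneEliminant.det_mem_span_pair F₀ F₁ (M.map PowerSeries.C) Q
    (fun l => PowerSeries.X ^ (l : ℕ)) ⟨0, hd⟩ (pow_zero _)
    (fun j => by simpa only [Matrix.map_apply] using hdiv j)
  have hC : (M.map PowerSeries.C).det = PowerSeries.C M.det := by
    rw [RingHom.map_det PowerSeries.C M, RingHom.mapMatrix_apply]
  rw [hC] at hmem
  obtain ⟨U, V, hUV⟩ := Ideal.mem_span_pair.mp hmem
  exact ⟨M, Q, U, V, hdiv, hUV.symm⟩

end CorankTwoEliminant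

open CorankTwoEliminant in
/-- **Eliminant membership over `ℂ⟦W, X₁⟧`** (piece D' of the stub `stub_nondegenerateCorankTwo`).
For `F₀, F₁ ∈ A₁⟦X⟧`, `A₁ = ℂ⟦W_0, …, W_{m-1}, X₁⟧ = MvPowerSeries (Option (Fin m)) ℂ`, with
`f_{0,j}(0) = 0` for `j < d` and `f_{0,d}(0) ≠ 0` (`f_{0,j}` the `X^j`-coefficient of `F₀`,
`d ≥ 1`), Weierstrass division of `X^j F₁` (`j < d`) by `F₀` yields quotients `Q_j` and a
`d × d` matrix `M` over `A₁` with `X^j F₁ = Q_j F₀ + Σ_{l<d} C (M_{lj}) X^l`, and `det M` lies in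
the ideal `(F₀, F₁)`: `C (det M) = U F₀ + V F₁`. -/
theorem eliminantMembership_option :
    ∀ (m d : ℕ) (F₀ F₁ : PowerSeries (MvPowerSeries (Option (Fin m)) ℂ)), 1 ≤ d →
      (∀ j < d, MvPowerSeries.constantCoeff (PowerSeries.coeff j F₀) = 0) →
      MvPowerSeries.constantCoeff (PowerSeries.coeff d F₀) ≠ 0 →
      ∃ (M : Matrix (Fin d) (Fin d) (MvPowerSeries (Option (Fin m)) ℂ))
        (Q : Fin d → PowerSeries (MvPowerSeries (Option (Fin m)) ℂ))
        (U V : PowerSeries (MvPowerSeries (Option (Fin m)) ℂ)),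
        (∀ j : Fin d, PowerSeries.X ^ (j : ℕ) * F₁ =
          Q j * F₀ + ∑ l : Fin d, PowerSeries.C (M l j) * PowerSeries.X ^ (l : ℕ)) ∧
        PowerSeries.C M.det = U * F₀ + V * F₁ :=
  fun _m d F₀ F₁ hd h0 hdd => eliminantMembership_sigma d F₀ F₁ hd h0 hdd

end Summit.ValiantsHypothesis.ValiantsHypothesis.Theorems.BinomialCandidateStubs

end
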